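import Summits.QuantumFields.BalabanUV.T4Continuum.Support.ShellMeasureLinearizedGammaTEnd
import Summits.QuantumFields.BalabanUV.T4Continuum.Support.ShellMeasureAverageAnalyticRegular

/-!
# `T4Continuum.ShellMeasureLinearizedGammaTLocal` — NE7c, audit γ3′ «THE REGULARITY HALF OF (LR)_j IS LOCAL», file 1∕2:
# p. 267's FIBRE MAP `h(c)` AND S46's `hop` AT ONE COARSE BOND `c` FROM THE LOOP REGIME OF THE BACKGROUND AT `c` ONLY
# (file 2 `ShellMeasureLinearizedGammaTLocalEnd`: W-d's (LR)_j END re-concluded from the two-block box of `c` alone)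
(cell `pub-balaban`, sub-cell `t4`, spine estimate NE7c (node U5b); NE7c ROUND-2 crew `t4-ne7c-formalise-*`, seat
`b2b-balaban-t4-ne7c-formalise-leaf-07` gen 8, own initiative (journal OFFER l.18240, FINDING-CANDIDATE
F-ne7cleaf07g8-1); imports S52 f2 `ShellMeasureLinearizedGammaTEnd` (p219653) + `ShellMeasureAverageAnalyticRegular`
(p219628) ONLY, everything BY NAME; [folklore]; TWO data `def`s (`hGenAt`, `hopΓAt` — re-threadings of the tree's `hGen … c` ∕
`hopΓ … c` with the located hypothesis, no new notion: `hGenAt_eq_hGen` is `rfl`, `hopΓAt_eq_hopΓ` by `rfl`) + the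
reducible name `hΓAt`, 0 `def … : Prop`, 0 sorry, 0 citations)

HONEST FRAMING.  Finite four-torus programme, rung (B)+1 only — NOT infinite volume, NOT a mass gap, NOT the Clay
problem, NOT summit progress; (B), `BetaPertHyp`, (B^μ) not consumed.  NE7c (`T4IndicatorShell.ShellWeightBound`) is
NOT PRINTED and NOT PROVED; «NE7c ⇐ the named binders» (trigger c3).  Nothing of [Balaban 1983–89] is asserted or
discharged: the background's plaquette regularity (B11 (19)–(21) ∕ B14 (2.16)–(2.17) ∕ [B12] p. 254 TYPE) stays a
DISPLAYED binder — this file only LOCATES it.  NOTHING in the countdown moves; spine PROVED 0∕9.  HONEST DEPENDENCY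
(cell, verbatim): continuum YM on T⁴ ⇐ BetaPertH ∧ nine spine estimates (0/9 proved); BetaPertH ⇐ (D1) ∧ (D4) ∧
CAP+tail; G-an2-4 gates asym, D1 and NE2/3/4.

THE POINT (an audit of OUR typing).  The (LR)_j ENDs of record — S52 `realForm_chartData_gammaT(_explicit∕_matrix)`,
the plug S60 `slotAC_linearizedWindow_gammaT(_matrix)` — carry the background's regularity binder GLOBALLY (`hW : ∀ c′,
∀ x ∈ offAxis L c′, …` over EVERY coarse bond of `ℤᵈ`, resp. `h44 : ∀ p ∈ ℤᵈ`), while every object the END builds at `c`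
reads `V` on `B(c₋) ∪ B(c₊)` only: the chart average `QtΓ L V c`, p. 267's fibre map `hGen … c = perturbInv (KMain c)
(Scorr c) _` (the global `hW` enters ONLY as the proof argument `relPert_lt_one : ∀ c′`), and the loop regime at `c` is
already located in the tree (`B12PlaquetteLoop267.norm_loopW_sub_one_le_local`).  At a live slot only the unit
plaquettes of `□^{∼4}` are co-tested (x-independent history factors; B14 (2.16): `□^{∼4}` lies in the term's small-field
region), while every (2.18)-term with a nonempty large-field region carries the COMPLEMENTARY characteristic functions
there — on its support the background violates the small-field bounds somewhere: the global binder holds on the support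
of no such term, the located one on the support of every term.
CONTENT (file 1).  §1 (any block-local, axis-straight `𝒯`) **`hGenAt`** — p. 267's fibre map at `c` with the LOCAL contraction
proof `relPert_lt_one_at`; `hGenAt_eq_hGen` (`rfl`); `bcoefL_hGenAt` ∕ `hGenAt_bcoefL` (two-sided inverse of the ℂ-linear
`bcoefL c`: S50 f2's `KMain_sub_Scorr_apply` + `perturb_perturbInv` ∕ `perturbInv_perturb`); `norm_hGenAt_le`;
`hGenAt_smul`; `hGenAt_star(_unitary)` (S50 f2's `bcoefVal_star` + `eventually_star_Qtilde_single`, per bond).  §2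
(`𝒯 = Γ`) **`hopΓAt`**, `hopΓAt_eq_hopΓ`, `fderiv_hopΓAt` («LQ̃h = I» through the Fréchet derivative: S48's per-bond
`bcoef_LQ_eq_apply_res` + `bcoef_LQ`), `norm_hopΓAt_le`, `hopΓAt_star`, `hΓAt`.  File 2: the located END (§3) and
the co-test reading (§4).
-/

noncomputable section

open Set Metric Filter Topology

namespace Summit.QuantumFields.BalabanUV.T4Continuum.ShellMeasureLinearizedGammaTLocal

open Literature.MathematicalPhysics.QuantumFieldTheory.Balaban1983to89
open Literature.MathematicalPhysics.QuantumLattice (ZdEdge blockSites blockBase plaquetteHolonomyZd)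
open B7BlockGeometry (qppBonds)
open B8Lemma1NonAbelian (pairTop omegaC omegaC_nonneg)
open B13CorridorSeparation (b0Z)
open B12HOperator267 (bcoef gammaT)
open B12HOperatorNeumann267 (relPert perturbInv perturb_perturbInv perturbInv_perturb KMain hH_of_budget
  norm_KMain_symm_le norm_relPert_le norm_perturbInv_le)
open B12AverageCorridor267 (Qtilde loopW offAxis mem_blockSites_of_mem_offAxis IsBlockLocal IsAxisStraightFamily LQ
  bcoefL bcoefL_apply bcoef_LQ Scorr axisStraight_conj norm_Rconj_le norm_Rconj_inv_le norm_Scorr_le norm_gcorner_le hGen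
  isBlockLocal_gammaT isAxisStraightFamily_gammaT)
open B12PlaquetteLoop267 (norm_loopW_sub_one_le_local thresholds_of_small)
open Summit.QuantumFields.BalabanUV.Beta.LinearizingChange267FromQ (nonlin Mq)
open ShellMeasureLinearizedRealStructure (realSub incl reP incl_reP_of_fixed conj_incl reP_incl)
open ShellMeasureLinearizedRealForm (realForm_rightInverse)
open ShellMeasureLinearizedConstraint (exists_splitting_of_rightInverse)
open ShellMeasureLinearizedFromQ (exists_realForm_chartData_of_Q)
open ShellMeasureAverageDerivative (bcoef_LQ_eq_apply_res hop_bound_nonneg)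
open ShellMeasureAverageHStructure (KMain_sub_Scorr_apply bcoefVal_star eventually_star_Qtilde_single)
open ShellMeasureAverageReal (theta theta_gammaT)
open ShellMeasureAverageAnalyticB7 (analyticOnNhd_Qtilde_gammaT norm_Qtilde_gammaT_le)
open ShellMeasureLinearizedGammaT (QtΓ QtΓ_zero κ𝔸 κΓ κ𝔸_invol κΓ_invol TΓ winΓ DtΓℝ hopΓ extend_smul
  extend_restrict_apply norm_restrict_single_le single_star QtΓ_conj)

variable {d : ℕ} {𝔸 : Type*} [NormedRing 𝔸] [NormedAlgebra ℂ 𝔸] [NormOneClass 𝔸] [CompleteSpace 𝔸]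
  {L : ℕ} {𝒯 : (ZdEdge d → 𝔸ˣ) → (Fin d → ℤ) → 𝔸ˣ}

/-! ## §1 p. 267's fibre map at ONE coarse bond from the loop regime AT THAT BOND -/

section Fibre

variable (hL : 0 < L) (h𝒯' : IsAxisStraightFamily L 𝒯) (V : ZdEdge d → 𝔸ˣ) {ε : ℝ} (hε0 : 0 ≤ ε) (hε : ε ≤ 1 / 8)
  (c : ZdEdge d) (hWc : ∀ x ∈ offAxis L c, ‖((loopW L 𝒯 V c x : 𝔸ˣ) : 𝔸) - 1‖ ≤ ε)
  (hV : ∀ b, ‖((V b : 𝔸ˣ) : 𝔸)‖ ≤ 1) (hV' : ∀ b, ‖(((V b)⁻¹ : 𝔸ˣ) : 𝔸)‖ ≤ 1)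
  (hbud : (L : ℝ) ^ d / L * (24 * ε) < 1)

include hL hε0 hε hWc hV hV' hbud in
/-- **THE NEUMANN BUDGET AT `c` FROM THE LOOPS AT `c`**: `(Lᵈ∕L)·‖S(c)‖ < 1` (`norm_Scorr_le` is per bond). [folklore] -/
theorem neumann_budget_at : (L : ℝ) ^ d / L * ‖Scorr L 𝒯 V c‖ < 1 :=
  lt_of_le_of_lt (mul_le_mul_of_nonneg_left
    (norm_Scorr_le hL 𝒯 V c hε0 hε hWc (norm_gcorner_le hV hV' c).1 (norm_gcorner_le hV hV' c).2)
    (by positivity)) hbud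

include hε0 hε hWc hbud in
/-- **THE CONTRACTION AT `c`**: `‖K(c)⁻¹S(c)‖ < 1` from the loops AT `c` only (`hH_of_budget` ∘ `norm_KMain_symm_le`).
[folklore] -/
theorem relPert_lt_one_at :
    ‖relPert (KMain (axisStraight_conj h𝒯' V) hL (norm_Rconj_le hV) (norm_Rconj_inv_le hV') c) (Scorr L 𝒯 V c)‖
      < 1 :=
  hH_of_budget (norm_KMain_symm_le (axisStraight_conj h𝒯' V) hL (norm_Rconj_le hV) (norm_Rconj_inv_le hV') c)
    (neumann_budget_at hL V hε0 hε c hWc hV hV' hbud)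

/-- **p. 267's FIBRE MAP `h(c) = (K(c) − S(c))⁻¹` WITH THE LOCATED HYPOTHESIS** — the tree's `hGen … c`
(`= hNeu … c = perturbInv (KMain c) (Scorr c) _`) re-threaded with the contraction proof AT `c`; no new notion
(`hGenAt_eq_hGen`). [folklore] -/
def hGenAt : 𝔸 →L[ℝ] 𝔸 :=
  perturbInv (KMain (axisStraight_conj h𝒯' V) hL (norm_Rconj_le hV) (norm_Rconj_inv_le hV') c) (Scorr L 𝒯 V c)
    (relPert_lt_one_at hL h𝒯' V hε0 hε c hWc hV hV' hbud)

/-- `hGenAt` IS the tree's `hGen … c` whenever the GLOBAL loop binder happens to hold (proof irrelevance). [folklore] -/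
theorem hGenAt_eq_hGen (hW : ∀ c', ∀ x ∈ offAxis L c', ‖((loopW L 𝒯 V c' x : 𝔸ˣ) : 𝔸) - 1‖ ≤ ε) :
    hGenAt hL h𝒯' V hε0 hε c (hW c) hV hV' hbud = hGen hL h𝒯' V hε0 hε hW hV hV' hbud c := rfl

/-- `bcoefL(c) (hGenAt c X) = X` (S50 f2's `bcoefL_hGen`, per bond). [folklore] -/
theorem bcoefL_hGenAt (X : 𝔸) : bcoefL L 𝒯 V c (hGenAt hL h𝒯' V hε0 hε c hWc hV hV' hbud X) = X := by
  rw [← KMain_sub_Scorr_apply hL h𝒯' V hV hV' c]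
  exact perturb_perturbInv _ _ (relPert_lt_one_at hL h𝒯' V hε0 hε c hWc hV hV' hbud) X

/-- `hGenAt c (bcoefL(c) X) = X` (S50 f2's `hGen_bcoefL`, per bond). [folklore] -/
theorem hGenAt_bcoefL (X : 𝔸) : hGenAt hL h𝒯' V hε0 hε c hWc hV hV' hbud (bcoefL L 𝒯 V c X) = X := by
  have h := perturbInv_perturb (KMain (axisStraight_conj h𝒯' V) hL (norm_Rconj_le hV) (norm_Rconj_inv_le hV') c)
    (Scorr L 𝒯 V c) (relPert_lt_one_at hL h𝒯' V hε0 hε c hWc hV hV' hbud) X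
  rwa [KMain_sub_Scorr_apply hL h𝒯' V hV hV' c] at h

omit [NormedRing 𝔸] [NormedAlgebra ℂ 𝔸] [NormOneClass 𝔸] [CompleteSpace 𝔸] in
/-- arithmetic: `m ≤ a`, `r ≤ a·t`, `a·t < 1`, `0 ≤ a` ⟹ `m∕(1 − r) ≤ a∕(1 − a·t)`. [folklore] -/
theorem div_budget_le {m a r t : ℝ} (hm : m ≤ a) (hr : r ≤ a * t) (ht : a * t < 1) (ha : 0 ≤ a) :
    m / (1 - r) ≤ a / (1 - a * t) :=
  (div_le_div_of_nonneg_right hm (by linarith)).trans (div_le_div_of_nonneg_left ha (by linarith) (by linarith))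

/-- **(iii) AT `c`**: `‖hGenAt c X‖ ≤ (Lᵈ∕L)∕(1 − (Lᵈ∕L)·24ε)·‖X‖` (`norm_perturbInv_le` + `‖S(c)‖ ≤ 24ε`). [folklore] -/
theorem norm_hGenAt_le (X : 𝔸) :
    ‖hGenAt hL h𝒯' V hε0 hε c hWc hV hV' hbud X‖ ≤ ((L : ℝ) ^ d / L) / (1 - (L : ℝ) ^ d / L * (24 * ε)) * ‖X‖ := by
  have hKM := norm_KMain_symm_le (axisStraight_conj h𝒯' V) hL (norm_Rconj_le hV) (norm_Rconj_inv_le hV') c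
  have ha : 0 ≤ (L : ℝ) ^ d / L := by positivity
  refine (norm_perturbInv_le _ _ (relPert_lt_one_at hL h𝒯' V hε0 hε c hWc hV hV' hbud) X).trans
    (mul_le_mul_of_nonneg_right (div_budget_le hKM ((norm_relPert_le _ _).trans
      ((mul_le_mul_of_nonneg_right hKM (norm_nonneg _)).trans (mul_le_mul_of_nonneg_left
        (norm_Scorr_le hL 𝒯 V c hε0 hε hWc (norm_gcorner_le hV hV' c).1 (norm_gcorner_le hV hV' c).2) ha))) hbud ha)
      (norm_nonneg X))

/-- `hGenAt c` is `ℂ`-homogeneous (the two-sided inverse of the `ℂ`-linear `bcoefL c`). [folklore] -/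
theorem hGenAt_smul (a : ℂ) (X : 𝔸) :
    hGenAt hL h𝒯' V hε0 hε c hWc hV hV' hbud (a • X) = a • hGenAt hL h𝒯' V hε0 hε c hWc hV hV' hbud X := by
  have h1 : a • X = bcoefL L 𝒯 V c (a • hGenAt hL h𝒯' V hε0 hε c hWc hV hV' hbud X) := by
    rw [map_smul, bcoefL_hGenAt]
  rw [h1, hGenAt_bcoefL]

section Star

variable [StarRing 𝔸] [StarModule ℂ 𝔸] [ContinuousStar 𝔸]

/-- **`hGenAt c` IS ⋆-EQUIVARIANT** under ⋆-equivariance of the average along the corridor curve at `c` (S50 f2's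
`hGen_star` proof, per bond). [folklore] -/
theorem hGenAt_star (h𝒯 : IsBlockLocal L 𝒯)
    (hstar : ∀ X : 𝔸, ∀ᶠ t : ℝ in 𝓝 0, star (Qtilde L 𝒯 V ((t : ℂ) • Pi.single (b0Z L c) X) c)
      = Qtilde L 𝒯 V ((t : ℂ) • Pi.single (b0Z L c) (star X)) c) (X : 𝔸) :
    hGenAt hL h𝒯' V hε0 hε c hWc hV hV' hbud (star X) = star (hGenAt hL h𝒯' V hε0 hε c hWc hV hV' hbud X) := by
  set Y := hGenAt hL h𝒯' V hε0 hε c hWc hV hV' hbud X with hY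
  have hW1 : ∀ x ∈ offAxis L c, ‖((loopW L 𝒯 V c x : 𝔸ˣ) : 𝔸) - 1‖ < 1 :=
    fun x hx => (hWc x hx).trans_lt (by linarith)
  have h1 : bcoefL L 𝒯 V c Y = X := bcoefL_hGenAt hL h𝒯' V hε0 hε c hWc hV hV' hbud X
  have h2 : bcoefL L 𝒯 V c (star Y) = star X := by
    rw [bcoefL_apply, bcoefVal_star hL h𝒯 h𝒯' V c Y hW1 (hstar Y), ← bcoefL_apply, h1]
  rw [← h2, hGenAt_bcoefL]

end Star

section Unitary

variable [StarRing 𝔸] [CStarRing 𝔸] [StarModule ℂ 𝔸]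

/-- **… OVER A UNITARY BACKGROUND IN A C⋆-ALGEBRA, NO `hstar` BINDER** (S50 f2's `eventually_star_Qtilde_single`,
per bond — its loop hypothesis is AT `c`). [folklore] -/
theorem hGenAt_star_unitary (h𝒯 : IsBlockLocal L 𝒯)
    (h𝒯θ : ∀ (U : ZdEdge d → 𝔸ˣ) (x : Fin d → ℤ), 𝒯 (fun b => theta (U b)) x = theta (𝒯 U x))
    (hVu : ∀ b, (V b : 𝔸) ∈ unitary 𝔸) (X : 𝔸) :
    hGenAt hL h𝒯' V hε0 hε c hWc hV hV' hbud (star X) = star (hGenAt hL h𝒯' V hε0 hε c hWc hV hV' hbud X) :=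
  hGenAt_star hL h𝒯' V hε0 hε c hWc hV hV' hbud h𝒯
    (eventually_star_Qtilde_single hL h𝒯 h𝒯' h𝒯θ hVu c fun x hx => (hWc x hx).trans_lt (by linarith)) X

end Unitary

end Fibre

/-! ## §2 The printed instance `𝒯 = Γ`: S46's `hop` at `c` from the loops at `c` -/

section Hop

variable (hL : 0 < L) (V : ZdEdge d → 𝔸ˣ) {ε : ℝ} (hε0 : 0 ≤ ε) (hε : ε ≤ 1 / 8) (c : ZdEdge d)
  (hWc : ∀ x ∈ offAxis L c, ‖((loopW L (fun U : ZdEdge d → 𝔸ˣ => gammaT L U) V c x : 𝔸ˣ) : 𝔸) - 1‖ ≤ ε)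
  (hV : ∀ b, ‖((V b : 𝔸ˣ) : 𝔸)‖ ≤ 1) (hV' : ∀ b, ‖(((V b)⁻¹ : 𝔸ˣ) : 𝔸)‖ ≤ 1)
  (hbud : (L : ℝ) ^ d / L * (24 * ε) < 1)

/-- **S46's `hop` FOR [B7] (15) AT `c`, LOCATED**: `X ↦ (δ_{b₀(c)}·hGenAt c X)|_{B(c₋)∪B(c₊)}`. [folklore] -/
def hopΓAt : 𝔸 →ₗ[ℂ] (↥(qppBonds L c) → 𝔸) where
  toFun X := fun i : ↥(qppBonds L c) =>
    (Pi.single (b0Z L c) (hGenAt hL (isAxisStraightFamily_gammaT hL) V hε0 hε c hWc hV hV' hbud X) : ZdEdge d → 𝔸) i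
  map_add' X Y := by
    funext i
    rw [map_add, Pi.single_add]
    rfl
  map_smul' a X := by
    funext i
    rw [hGenAt_smul, Pi.single_smul]
    rfl

/-- unfolding. [folklore] -/
theorem hopΓAt_apply (X : 𝔸) :
    hopΓAt hL V hε0 hε c hWc hV hV' hbud X = fun i : ↥(qppBonds L c) =>
      (Pi.single (b0Z L c) (hGenAt hL (isAxisStraightFamily_gammaT hL) V hε0 hε c hWc hV hV' hbud X) :
        ZdEdge d → 𝔸) i :=
  rfl

/-- `hopΓAt` IS the tree's `hopΓ … c` whenever the global loop binder happens to hold. [folklore] -/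
theorem hopΓAt_eq_hopΓ
    (hW : ∀ c', ∀ x ∈ offAxis L c', ‖((loopW L (fun U : ZdEdge d → 𝔸ˣ => gammaT L U) V c' x : 𝔸ˣ) : 𝔸) - 1‖ ≤ ε) :
    hopΓAt hL V hε0 hε c (hW c) hV hV' hbud = hopΓ hL V hε0 hε hW hV hV' hbud c :=
  LinearMap.ext fun _ => rfl

/-- **S46's `hHop` AT `c`**: `‖hopΓAt X‖ ≤ (Lᵈ∕L)∕(1 − (Lᵈ∕L)·24ε)·‖X‖`. [folklore] -/
theorem norm_hopΓAt_le (X : 𝔸) :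
    ‖hopΓAt hL V hε0 hε c hWc hV hV' hbud X‖ ≤ ((L : ℝ) ^ d / L) / (1 - (L : ℝ) ^ d / L * (24 * ε)) * ‖X‖ :=
  (norm_restrict_single_le _).trans (norm_hGenAt_le hL _ V hε0 hε c hWc hV hV' hbud X)

/-- **S46's `hLQh` AT `c`**: `A (hopΓAt X) = X` for every Fréchet derivative `A` of the chart average at `0` (S48's
per-bond `bcoef_LQ_eq_apply_res` + `bcoef_LQ`; the loops AT `c` only). [folklore] -/
theorem fderiv_hopΓAt {A : (↥(qppBonds L c) → 𝔸) →L[ℂ] 𝔸} (hF : HasFDerivAt (QtΓ L V c) A 0) (X : 𝔸) :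
    A (hopΓAt hL V hε0 hε c hWc hV hV' hbud X) = X := by
  have hW1 : ∀ x ∈ offAxis L c, ‖((loopW L (fun U : ZdEdge d → 𝔸ˣ => gammaT L U) V c x : 𝔸ˣ) : 𝔸) - 1‖ < 1 :=
    fun x hx => (hWc x hx).trans_lt (by linarith)
  rw [hopΓAt_apply, ← bcoef_LQ_eq_apply_res (fun B : ↥(qppBonds L c) → 𝔸 =>
      Function.extend Subtype.val B (0 : ZdEdge d → 𝔸)) (fun (B' : ZdEdge d → 𝔸) (i : ↥(qppBonds L c)) => B' i)
      (fun s v => extend_smul s v) hL (isBlockLocal_gammaT hL) V c (fun B' _ hb => extend_restrict_apply B' hb)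
      (fun _ => rfl) hF, bcoef_LQ hL (isBlockLocal_gammaT hL) (isAxisStraightFamily_gammaT hL) V c _ hW1, ← bcoefL_apply]
  exact bcoefL_hGenAt hL _ V hε0 hε c hWc hV hV' hbud X

variable [StarRing 𝔸] [CStarRing 𝔸] [StarModule ℂ 𝔸]

/-- **S46's `hhop` AT `c`**: `hopΓAt (X⋆) = (hopΓAt X)⋆` from the fibre map's ⋆-equivariance. [folklore] -/
theorem hopΓAt_star
    (hhop0 : ∀ X, hGenAt hL (isAxisStraightFamily_gammaT hL) V hε0 hε c hWc hV hV' hbud (star X)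
      = star (hGenAt hL (isAxisStraightFamily_gammaT hL) V hε0 hε c hWc hV hV' hbud X)) (X : 𝔸) :
    hopΓAt hL V hε0 hε c hWc hV hV' hbud (κ𝔸 𝔸 X) = κΓ 𝔸 L c (hopΓAt hL V hε0 hε c hWc hV hV' hbud X) := by
  rw [starₗᵢ_apply, starₗᵢ_apply, hopΓAt_apply, hopΓAt_apply, hhop0, single_star]
  rfl

/-- the fibre ⋆-identity AT `c` over a unitary background, [B7] (15) verbatim (`theta_gammaT` BY NAME). [folklore] -/
theorem hGenAt_star_gammaT_unitary (hVu : ∀ b, (V b : 𝔸) ∈ unitary 𝔸) (X : 𝔸) :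
    hGenAt hL (isAxisStraightFamily_gammaT hL) V hε0 hε c hWc hV hV' hbud (star X)
      = star (hGenAt hL (isAxisStraightFamily_gammaT hL) V hε0 hε c hWc hV hV' hbud X) :=
  hGenAt_star_unitary hL (isAxisStraightFamily_gammaT hL) V hε0 hε c hWc hV hV' hbud (isBlockLocal_gammaT hL)
    (theta_gammaT L) hVu X

/-- the REAL FORM of the located `hop`: `reP ∘ hopΓAt↾ℝ ∘ incl : Fix(⋆_𝔸) → Fix(⋆)` (S52 f1's `hΓ`, located).
[folklore] -/
abbrev hΓAt : realSub (κ𝔸 𝔸) →L[ℝ] realSub (κΓ 𝔸 L c) :=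
  reP (κΓ 𝔸 L c) κΓ_invol ∘L ((hopΓAt hL V hε0 hε c hWc hV hV' hbud).mkContinuous _
    (norm_hopΓAt_le hL V hε0 hε c hWc hV hV' hbud)).restrictScalars ℝ ∘L incl (κ𝔸 𝔸)

end Hop

end Summit.QuantumFields.BalabanUV.T4Continuum.ShellMeasureLinearizedGammaTLocal

end
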